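import Summits.Ventures.PercRepro.ThetaMultiWeakSplit

/-!
# (Θ_∞): the Weak Split Lemma in its labelled form — the statement of record

Dossier proofs/MINE1-theoremS.md, Addendum 76 suppl. 3 (mine-1, gen 39). **Correction.** The
choice-free form `MultiWeakSplit α` of ThetaMultiWeakSplit.lean (partners paid by the credit
`creditE`) is FALSE on ground sets of five points: for the valid instance with sixteen members in
four classes `6+0 f-3 5-1 9+3 2+3 d-3 7-3 4+3 b-3 8+3 1+3 c+3 0+3 a+3 e+0 3+1` on `U = [4]` with
base point `r` (a tight instance, `|D_∞| = 16`), every point has strictly fewer `e`-edges in the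
family than partner pairs (margins `−3, −5, −3, −1, −1`), so no `(e, T)` satisfies the credit
inequality — while at every point some labelling `T` of the projection has
`|D_∞(A)| − |D_∞(T)| = #partners` (kit j313165, verified by two own programs). The theorem
`conjThetaMulti_of_weakSplit` is therefore vacuous from five points on, and the Weak Split Lemma
of record is the **labelled form** below, in which the whole difference `|multiDRel U A| −
|multiDRel (U ∖ e) T|` — the credit plus the part of the union `D_e' ∪ D_{¬e}` that `T` leaves
unused — pays the partner pairs:

* `MultiWeakSplitLabelled α` — every valid instance on a nonempty ground set has a point `e` and a
  valid sub-labelling `T` of its projection with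
  `∑ᵢ |projE e A i| + ∑ᵢ |partE e A i| + |multiDRel (U ∖ e) T| ≤ ∑ᵢ |T i| + |multiDRel U A|`
  (exhaustively true on 4 points for every labelled family, on 5 points for `k ≤ 6` and for every
  one of the 95,733 strong-split failures of Addendum 73; unbroken by annealing on 5–7 points);
* `multiWeakSplitLabelled_of_multiWeakSplit` — the choice-free form implies the labelled one;
* `sum_card_le_card_multiDRel_of_subset_projE_labelled` — the induction step in the labelled form
  (pure arithmetic from the count `∑ᵢ |A i| = ∑ᵢ |projE e A i| + ∑ᵢ |partE e A i|`);
* `multiValidRel_sum_card_le_of_weakSplitLabelled`, `conjThetaMulti_of_weakSplitLabelled` —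
  **the labelled Weak Split Lemma implies (Θ_∞)**.
-/

namespace PercRepro.MSTight

open Finset

variable {α : Type*} [DecidableEq α] [Fintype α]

/-- **The Weak Split Lemma, labelled form** (the statement of record): every valid instance on a
nonempty ground set has a point `e` and a valid sub-labelling `T` of its projection with
`∑ᵢ |projE e A i| + ∑ᵢ |partE e A i| + |multiDRel (U ∖ e) T| ≤ ∑ᵢ |T i| + |multiDRel U A|`. -/
def MultiWeakSplitLabelled (α : Type*) [DecidableEq α] [Fintype α] : Prop :=
  ∀ (U : Finset α) (m : ℕ) (A : Fin m → Finset (Finset α)), MultiValidRel U A → U.Nonempty →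
    ∃ e ∈ U, ∃ T : Fin m → Finset (Finset α), (∀ i, T i ⊆ projE e A i) ∧
      MultiValidRel (U.erase e) T ∧
      ∑ i, (projE e A i).card + ∑ i, (partE e A i).card + (multiDRel (U.erase e) T).card ≤
        ∑ i, (T i).card + (multiDRel U A).card

/-- The choice-free form implies the labelled form (by the exact step for a sub-labelling). -/
theorem multiWeakSplitLabelled_of_multiWeakSplit (h : MultiWeakSplit α) :
    MultiWeakSplitLabelled α := by
  intro U m A hv hne
  obtain ⟨e, he, T, hT, hTv, hK⟩ := h U m A hv hne
  refine ⟨e, he, T, hT, hTv, ?_⟩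
  have := card_multiDRel_add_card_creditE_le_of_subset_projE (U := U) hT
  omega

omit [Fintype α] in
/-- **The induction step in the labelled form**: (Θ_∞) on `U ∖ e` for a sub-labelling `T` of the
projection and the labelled count give (Θ_∞) on `U` for `A`. -/
theorem sum_card_le_card_multiDRel_of_subset_projE_labelled {ι : Type*} [DecidableEq ι]
    [Fintype ι] {U : Finset α} {e : α} {A T : ι → Finset (Finset α)}
    (hP : ∑ i, (T i).card ≤ (multiDRel (U.erase e) T).card)
    (hK : ∑ i, (projE e A i).card + ∑ i, (partE e A i).card + (multiDRel (U.erase e) T).card ≤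
      ∑ i, (T i).card + (multiDRel U A).card) :
    ∑ i, (A i).card ≤ (multiDRel U A).card := by
  have hsum : ∑ i, (A i).card = ∑ i, (projE e A i).card + ∑ i, (partE e A i).card := by
    rw [← sum_add_distrib]
    exact Finset.sum_congr rfl fun i _ => (card_projE_add_card_partE i).symm
  omega

/-- **The labelled Weak Split Lemma implies (Θ_∞) relative to every ground set.** -/
theorem multiValidRel_sum_card_le_of_weakSplitLabelled (h : MultiWeakSplitLabelled α) :
    ∀ (U : Finset α) (m : ℕ) (A : Fin m → Finset (Finset α)), MultiValidRel U A →
      ∑ i, (A i).card ≤ (multiDRel U A).card := by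
  intro U
  induction U using Finset.strongInduction with
  | H U ih =>
    intro m A hv
    rcases U.eq_empty_or_nonempty with rfl | hne
    · rw [sum_card_eq_zero_of_multiValidRel_empty hv]
      exact Nat.zero_le _
    · obtain ⟨e, he, T, _, hTv, hK⟩ := h U m A hv hne
      exact sum_card_le_card_multiDRel_of_subset_projE_labelled
        (ih (U.erase e) (erase_ssubset he) m T hTv) hK

/-- **The labelled Weak Split Lemma implies Conjecture (Θ_∞).** -/
theorem conjThetaMulti_of_weakSplitLabelled (h : MultiWeakSplitLabelled α) : ConjThetaMulti α := by
  intro m A hv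
  rw [← multiDRel_univ]
  exact multiValidRel_sum_card_le_of_weakSplitLabelled h univ m A ((multiValidRel_univ A).2 hv)

end PercRepro.MSTight
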